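import Summits.HodgeConjecture.HodgeConjecture.Theorems.NikulinTwinTransportTwinSimilitudeAlgebraicCMNormSelfAnchor
import Summits.HodgeConjecture.HodgeConjecture.Theorems.NikulinTwinTransportTwinSimilitudeAlgebraicStubWittCompletionAux
import Literature.AlgebraicGeometry.Surfaces.K3HodgeTypesHolds
import HarnessLib

/-!
# Route NikulinTwinTransport · crux X = `TwinSimilitudeAlgebraic` (stmt-HodgeConjecture-13674) —
# stub `stub_cmRationalForm` of line `hyperkaehler-nikulin-anchors` (reshape r11): the `ℚ`-form of a
# CM-norm-2 structure under a marking

Let `S` be a projective K3 surface with integral generator `p` of `H⁴(S(ℂ); ℂ)`, `e` a rational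
`2`-self-similitude of `H²(S(ℂ); ℂ)` (`(x.y) = a·p ⟹ (ex.ey) = 2a·p`) with `e σ = t σ` on a non-zero
`(2,0)`-class `σ`, `t` non-real, and `(η, p₀, x₀)` a marking (the six clauses of
`Huybrechts_K3_marking_exists`).  `stub_cmRationalForm` reads this CM-norm-2 structure over `ℚ`:

* the conjugate `J = η ∘ e ∘ η⁻¹` (defined over `ℚ`, doubling the K3 form, `J x₀ = t x₀`:
  `cmNorm_markingConj`) descends to a `ℚ`-linear automorphism `Jq` of `Λ_ℚ = ℚ²²`
  (`exists_ratEnd_of_forall_intCast`; injective as a similitude of the non-degenerate K3 form) with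
  `η (e (η⁻¹ u)) = Jq u` on `Λ_ℚ` and `(Jq v.Jq w) = 2 (v.w)` for the rational K3 form `k3FormRat`;
* the rational Néron–Severi points `N_ℚ = {u ∈ Λ_ℚ | η⁻¹ u ∈ NS(S)}` (`exists_nsRat`: non-degenerate by
  the Hodge index theorem) are `Jq`-stable — `e` is type-preserving (`cmNorm_typePreserving`) and maps
  `NS(S)` into itself (`map_mem_algebraicClasses_of_hodgeMap`, Lefschetz `(1,1)`);
* `Jq² − 2` is injective on `N_ℚ^⊥`: if `w ⊥ N_ℚ` and `Jq² w = 2 w` then `4 (w.x₀) = (J²w.J²x₀) =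
  2t² (w.x₀)` with `t² ≠ 2`, so `(w.x₀) = 0`, likewise `(w.x̄₀) = 0` (`J` is real, `ratEnd_star`); hence
  `η⁻¹ w` is a rational `(1,1)`-class (`Huybrechts_K3_hodgeTypes_H2_holds`, markings are real:
  `conjClass_marking_symm`), algebraic by Lefschetz `(1,1)`, i.e. `w ∈ N_ℚ ∩ N_ℚ^⊥ = 0`.

No definitions, no new named facts, no `sorry`.  References: Huybrechts, *Lectures on K3 Surfaces*
(CUP 2016) Ch. 3 Lemma 3.1, Cor. 3.6; Buskin, J. reine angew. Math. 755 (2019) §6.2 (markings).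
-/

noncomputable section

set_option linter.dupNamespace false

open CategoryTheory MonoidalCategory
open scoped Manifold Matrix
open Literature.AlgebraicGeometry.Motives Literature.AlgebraicGeometry.HodgeTheory
open Literature.AlgebraicGeometry.Surfaces Literature.Geometry.Kaehler
open Literature.AlgebraicTopology.SingularHomology
open Summit.HodgeConjecture.HodgeConjecture.Theses.NikulinTwinTransport

namespace Summit.HodgeConjecture.HodgeConjecture.Theorems.NikulinTwinTransport

/-! ## Local notations (verbatim those of the line's skeleton r11) -/

/-- `Gen[S, p]`: `p` is an integral generator of `H⁴(S(ℂ); ℂ)`. Local notation only. -/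
local notation3 (prettyPrint := false) "Gen[" S ", " p "]" =>
  (IsIntegralClass p ∧ ∀ q : complexBetti S (2 * 2), IsIntegralClass q → ∃ n : ℤ, q = n • p)

/-- `MarkedK3[S, η, p, x]`: a marked K3 surface with period `x`. Local notation only. -/
local notation3 (prettyPrint := false) "MarkedK3[" S ", " η ", " p ", " x "]" =>
  (IsIntegralClass p ∧
    (∀ q : complexBetti S (2 * 2), IsIntegralClass q → ∃ n : ℤ, q = n • p) ∧
    (∀ c : complexBetti S (2 * 1), IsIntegralClass c ↔ ∃ v : K3Index → ℤ, η c = fun i => (v i : ℂ)) ∧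
    (∀ a b : complexBetti S (2 * 1),
        cupProduct (rfl : 2 * 1 + 2 * 1 = 2 * 2) a b = k3Form (η a) (η b) • p) ∧
    IsOfHodgeType 2 S (2 * 1) 2 0 (LinearEquiv.symm η x) ∧
    (∀ τ : complexBetti S (2 * 1), IsOfHodgeType 2 S (2 * 1) 2 0 τ → ∃ t : ℂ, τ = t • LinearEquiv.symm η x))

/-! ## Two scalar lemmas -/

/-- A complex number with non-zero imaginary part does not square to `2`. [folklore] -/
private theorem mul_self_ne_two_of_im_ne_zero {s : ℂ} (hs : s.im ≠ 0) : s * s ≠ 2 := by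
  intro h
  have hre := congrArg Complex.re h
  have him := congrArg Complex.im h
  simp only [Complex.mul_re, Complex.mul_im, Complex.re_ofNat, Complex.im_ofNat] at hre him
  have hre0 : s.re = 0 := by
    have h2 : s.re * s.im = 0 := by linarith
    exact (mul_eq_zero.1 h2).resolve_right hs
  rw [hre0] at hre
  nlinarith [sq_nonneg s.im]

/-- **The eigen-orthogonality of a `2`-similitude.** If `J` doubles the K3 form, `J (J c) = 2c` and
`J x = s x` with `s` non-real, then `(c.x) = 0`: `4 (c.x) = (J²c.J²x) = 2 s² (c.x)` and `s² ≠ 2`.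
[cite: Huybrechts2016K3, Ch. 3 Cor. 3.6] -/
private theorem k3Form_eq_zero_of_cmEigen {J : Module.End ℂ (K3Index → ℂ)}
    (hJ2 : ∀ a b, k3Form (J a) (J b) = 2 * k3Form a b) {c x : K3Index → ℂ} {s : ℂ}
    (hc : J (J c) = (2 : ℂ) • c) (hx : J x = s • x) (hs : s.im ≠ 0) : k3Form c x = 0 := by
  have h := hJ2 (J c) (J x)
  rw [hJ2 c x, hc, hx, map_smul, hx, k3Form_smul_left, k3Form_smul_right, k3Form_smul_right] at h
  have h' : (s * s - 2) * k3Form c x = 0 := by linear_combination (1 / 2 : ℂ) * h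
  exact (mul_eq_zero.1 h').resolve_left (sub_ne_zero.2 (mul_self_ne_two_of_im_ne_zero hs))

/-! ## The stub -/

/-- **The `ℚ`-form of a CM-norm-2 structure under a marking.** For a projective K3 surface `S` with
generator `p` of `H⁴`, a rational `2`-self-similitude `e` of `H²(S)` with `e σ = t σ` (`σ ≠ 0` of type
`(2,0)`, `t` non-real) and a marking `(η, p₀, x₀)`: the conjugate `η ∘ e ∘ η⁻¹` descends to a
`ℚ`-linear automorphism `Jq` of `Λ_ℚ` doubling the rational K3 form; the rational Néron–Severi points
`N_ℚ` (non-degenerate, Hodge index) are `Jq`-stable (`e` is type-preserving, Lefschetz `(1,1)`); and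
`Jq² − 2` is injective on `N_ℚ^⊥`: a `w ⊥ N_ℚ` with `Jq² w = 2w` is orthogonal to `x₀` and `x̄₀`
(`t² ≠ 2`), hence `η⁻¹ w` is a rational `(1,1)`-class, algebraic by Lefschetz, so `w ∈ N_ℚ ∩ N_ℚ^⊥ = 0`.
[cite: Huybrechts2016K3, Ch. 3 Cor. 3.6 and Lemma 3.1] [cite: Buskin2019, §6.2 (markings)] -/
theorem stub_cmRationalForm :
    Huybrechts_K3_marking_exists → LefschetzOneOneK3 → AlgebraicClassesOneOneK3 →
    (∀ (S : SchemeOver ℂ), IsK3Surface S → hodgeIndex_surface S) →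
      ∀ (S : SchemeOver ℂ) (hS : IsK3Surface S) (p : complexBetti S (2 * 2)), Gen[S, p] →
      ∀ (e : complexBetti S (2 * 1) →ₗ[ℂ] complexBetti S (2 * 1)),
        (∀ x, IsRationalClass x → IsRationalClass (e x)) →
        (∀ (x y : complexBetti S (2 * 1)) (a : ℂ),
          cupProduct (rfl : 2 * 1 + 2 * 1 = 2 * 2) x y = a • p →
            cupProduct (rfl : 2 * 1 + 2 * 1 = 2 * 2) (e x) (e y) = ((2 : ℂ) * a) • p) →
        ∀ (σ : complexBetti S (2 * 1)) (t : ℂ), IsOfHodgeType 2 S (2 * 1) 2 0 σ → σ ≠ 0 → t.im ≠ 0 →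
          e σ = t • σ →
        ∀ (η : complexBetti S (2 * 1) ≃ₗ[ℂ] (K3Index → ℂ)) (p₀ : complexBetti S (2 * 2)) (x₀ : K3Index → ℂ),
          MarkedK3[S, η, p₀, x₀] →
          ∃ (Jq : (K3Index → ℚ) ≃ₗ[ℚ] (K3Index → ℚ)) (NQ : Submodule ℚ (K3Index → ℚ)),
            (∀ u : K3Index → ℚ, η (e (η.symm fun i => (u i : ℂ))) = fun i => (Jq u i : ℂ)) ∧
            (∀ v w, k3FormRat (Jq v) (Jq w) = 2 * k3FormRat v w) ∧
            (∀ u, u ∈ NQ ↔ η.symm (fun j => (u j : ℂ)) ∈ algebraicClasses S 1) ∧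
            (k3FormRat.restrict NQ).Nondegenerate ∧
            (∀ u ∈ NQ, Jq u ∈ NQ) ∧
            (∀ w ∈ k3FormRat.orthogonal NQ, Jq (Jq w) = (2 : ℚ) • w → w = 0) := by
  intro hmk hL hN hHI S hS p hp e he_rat he_sim σ t hσ hσ0 htim heσ η p₀ x₀ hm
  -- `J := η ∘ e ∘ η⁻¹` is defined over `ℚ`, doubles the K3 form, `J x₀ = t x₀`
  obtain ⟨hJrat, hJ2, hJx, -⟩ := cmNorm_markingConj hS hp η p₀ x₀ hm e he_rat he_sim hσ hσ0 heσ
  have he_typ : ∀ (i j : ℕ) x, IsOfHodgeType 2 S (2 * 1) i j x → IsOfHodgeType 2 S (2 * 1) i j (e x) :=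
    cmNorm_typePreserving hmk hS hp e he_rat he_sim hσ hσ0 heσ
  obtain ⟨-, hgen₀, hint, hcup, h20, huniq⟩ := hm
  have hp₀0 : p₀ ≠ 0 := generator_ne_zero hS hgen₀
  set J : Module.End ℂ (K3Index → ℂ) := η.toLinearMap ∘ₗ e ∘ₗ η.symm.toLinearMap
  have hJapp : ∀ z, J z = η (e (η.symm z)) := fun z => rfl
  -- `J` is injective (a `2`-similitude of the non-degenerate K3 form)
  have hJinj : Function.Injective J := by
    refine (injective_iff_map_eq_zero J).2 fun a ha => k3Form_eq_zero_of_forall fun b => ?_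
    have h := hJ2 a b
    rw [ha, k3Form_zero_left] at h
    exact (mul_eq_zero.1 h.symm).resolve_left two_ne_zero
  -- descend `J` to `Λ_ℚ`
  obtain ⟨τ, hτ⟩ := exists_ratEnd_of_forall_intCast J hJrat
  have hτinj : Function.Injective τ := by
    refine (injective_iff_map_eq_zero τ).2 fun u hu => ?_
    apply ratCastΛ_injective
    rw [ratCastΛ_zero]
    apply hJinj
    rw [hτ u, hu, map_zero]
    exact ratCastΛ_zero
  let Jq : (K3Index → ℚ) ≃ₗ[ℚ] (K3Index → ℚ) := LinearEquiv.ofInjectiveEndo τ hτinj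
  have hJq : ∀ u : K3Index → ℚ, J (fun i => (u i : ℂ)) = fun i => (Jq u i : ℂ) := hτ
  have hJq2 : ∀ v w, k3FormRat (Jq v) (Jq w) = 2 * k3FormRat v w := fun v w => by
    apply Rat.cast_injective (α := ℂ)
    rw [← k3Form_ratCast, ← hJq, ← hJq, hJ2, k3Form_ratCast]
    push_cast
    rfl
  -- the rational Néron–Severi points
  obtain ⟨NQ, memNQ, hNQ, -, -, -⟩ := exists_nsRat hS (hHI S hS) η hp₀0 hint hcup
  refine ⟨Jq, NQ, fun u => (hJapp _).symm.trans (hJq u), hJq2, memNQ, hNQ, fun u hu => ?_,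
    fun w hw hJJw => ?_⟩
  · -- `N_ℚ` is `Jq`-stable: `e` maps `NS(S)` into itself
    rw [memNQ, ← hJq, hJapp, LinearEquiv.symm_apply_apply]
    exact map_mem_algebraicClasses_of_hodgeMap hS hS hL hN e he_rat (fun x hx => he_typ 1 1 x hx)
      ((memNQ u).1 hu)
  · -- the heart: `Jq² w = 2 w` with `w ⊥ N_ℚ` forces `w = 0`
    have hJJ : J (J fun i => (w i : ℂ)) = (2 : ℂ) • fun i => (w i : ℂ) := by
      rw [hJq, hJq, hJJw, ratCastΛ_smul]
      push_cast
      rfl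
    -- `(w.x₀) = 0 = (w.x̄₀)`
    have hK : k3Form (fun i => (w i : ℂ)) x₀ = 0 := k3Form_eq_zero_of_cmEigen hJ2 hJJ hJx htim
    have hJx' : J (star x₀) = star t • star x₀ := by
      rw [ratEnd_star J hJrat x₀, hJx, star_smul]
    have htim' : (star t).im ≠ 0 := by
      rw [Complex.star_def, Complex.conj_im]
      exact neg_ne_zero.2 htim
    have hK' : k3Form (fun i => (w i : ℂ)) (star x₀) = 0 :=
      k3Form_eq_zero_of_cmEigen hJ2 hJJ hJx' htim'
    -- `η⁻¹ w` is a rational `(1,1)`-class, hence algebraic (Lefschetz)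
    have hσ₀0 : η.symm x₀ ≠ 0 := by
      intro h0
      obtain ⟨t', ht'⟩ := huniq σ hσ
      rw [h0, smul_zero] at ht'
      exact hσ0 ht'
    obtain ⟨-, -, h3⟩ := Huybrechts_K3_hodgeTypes_H2_holds S hS (η.symm x₀) h20 hσ₀0
    have hrat : IsRationalClass (η.symm fun i => (w i : ℂ)) :=
      (isRationalClass_iff_of_marking hS η hint _).2 ⟨w, η.apply_symm_apply _⟩
    have h11 : IsOfHodgeType 2 S (2 * 1) 1 1 (η.symm fun i => (w i : ℂ)) := by
      refine (h3 _).2 ⟨?_, ?_⟩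
      · rw [hcup, LinearEquiv.apply_symm_apply, LinearEquiv.apply_symm_apply, hK, zero_smul]
      · rw [conjClass_marking_symm η hint x₀, hcup, LinearEquiv.apply_symm_apply,
          LinearEquiv.apply_symm_apply, hK', zero_smul]
    have hwN : w ∈ NQ := (memNQ w).2 (hL S hS _ hrat h11)
    -- `w ∈ N_ℚ ∩ N_ℚ^⊥ = 0`
    exact Submodule.disjoint_def.1
      (LinearMap.BilinForm.isCompl_orthogonal_of_restrict_nondegenerate
        k3FormRat_isSymm.isRefl hNQ).disjoint w hwN hw

end Summit.HodgeConjecture.HodgeConjecture.Theorems.NikulinTwinTransport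

end
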